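import Literature.AlgebraicGeometry.HodgeTheory.ComplexGysinCorrespondence
import Literature.AlgebraicGeometry.HodgeTheory.SupportedHodgeClassDescent
import Literature.AlgebraicGeometry.HodgeTheory.GysinKernelProofs
import Literature.AlgebraicTopology.SingularHomology.GysinMapSupportProofs
import HarnessLib

/-!
# Stub `stub_isAlgebraicCorrespondence_gysin_comp_corrAction` (S2c) of line `birth` of the crux
# `ConiveauOneFailure` (route `SecondaryPeriods`, stmt-HodgeConjecture-3540): a Gysin map composed
# with the action of an algebraic correspondence is the action of an algebraic correspondence

For an orientation family `μ`, smooth projective `W'`, `W`, `X` over `ℂ` of dimensions `m'`, `m`, `n`,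
a morphism `k : W' ⟶ W` and a class `γ ∈ H^{2e}((W' ⊗ X)(ℂ); ℂ)`, the action
`[γ]_* : Hᵃ(X(ℂ)) → Hᵇ(W'(ℂ))`, `c ↦ pr_{W'*}(pr_X^* c ∪ γ)` (`corrAction`, Voisin II (10.7)),
post-composed with the Gysin map `k_* : Hᵇ(W'(ℂ)) → H^{b'}(W(ℂ))` is the action of the pushed class
`(k ⊗ 𝟙_X)_* γ ∈ H^{2e'}((W ⊗ X)(ℂ); ℂ)`:

  `k_* ∘ [γ]_* = [(k ▷ X)_* γ]_*`   (`complexGysin_comp_corrAction_eq_corrAction_whiskerRight`),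

by the projection formula `(k ▷ X)_*((k ▷ X)^* pr_X^* c ∪ γ) = pr_X^* c ∪ (k ▷ X)_* γ`
(`complexGysin_cup`), functoriality `pr_{W*} ∘ (k ▷ X)_* = ((k ▷ X) ≫ pr_W)_* = (pr_{W'} ≫ k)_* =
k_* ∘ pr_{W'*}` (`complexGysin_comp`, Mathlib `whiskerRight_fst`) and `(k ▷ X) ≫ pr_X = pr_X`
(`whiskerRight_snd`) — W. Fulton, *Intersection Theory* (1998), Prop. 16.1.1 (c) with a graph, resp.
*Young Tableaux* (1997), App. B §B.1 (5)–(6); C. Voisin, *Hodge Theory and Complex Algebraic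
Geometry II* (2003), proof of Thm. 10.17, (10.8): "`[Z'']^* = l_* ∘ [Z̃'']^*`". This is the
`complexGysin μ` version of the tree's `GysinFormalism.corrAct_cyclesOfDimMap_whiskerRight`
(hypothesis-structure version, `GysinFormalismPushforward`), whose proof is adapted here.

Since push-forwards of algebraic classes are algebraic (`complexGysin_mem_algebraicClasses`, with the
proved support fact `gysinMap_restrictCompl_eq_zero_of_field ℂ` and Poincaré duality
`OrientationFamily.hasPoincareDuality`), and the action of an algebraic class is induced by an
algebraic correspondence (`isAlgebraicCorrespondence_corrAction`), the registered stub follows: for a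
surface `g : S → Y` in a threefold, a curve `C` and an algebraic divisor class `γ` on `S ⊗ C`,
`g_* ∘ [γ]_* : H¹(C(ℂ)) → H³(Y(ℂ))` satisfies `IsAlgebraicCorrespondence 3 1 Y C`
(`stub_isAlgebraicCorrespondence_gysin_comp_corrAction`, the statement registered in
`Cruxes/ConiveauOneFailure/Lines/birth.lean`, verbatim).

References: W. Fulton, Intersection Theory (1998), §16.1 Prop. 16.1.1; W. Fulton, Young Tableaux
(1997), App. B §B.1 (5)–(6); C. Voisin, Hodge Theory and Complex Algebraic Geometry II (2003), proof
of Thm. 10.17 (10.7)–(10.8).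
-/

noncomputable section

-- every declaration of this problem lives in `Summit.HodgeConjecture.HodgeConjecture.…` (summit =
-- sub-problem), which `linter.dupNamespace` flags
set_option linter.dupNamespace false

namespace Summit.HodgeConjecture.HodgeConjecture.Theorems

open CategoryTheory MonoidalCategory CartesianMonoidalCategory
open Literature.AlgebraicGeometry.Motives Literature.AlgebraicGeometry.HodgeTheory
  Literature.AlgebraicTopology.SingularHomology

/-- **`k_* ∘ [γ]_* = [(k ▷ X)_* γ]_*`** (Voisin II (10.8), for classes and the Gysin morphisms
`complexGysin μ`): for `k : W' ⟶ W` (`dim W' = m'`, `dim W = m`), `X` of dimension `n` and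
`γ ∈ H^{2e}((W' ⊗ X)(ℂ); ℂ)`, the action of the pushed class
`(k ▷ X)_* γ ∈ H^{2e'}((W ⊗ X)(ℂ); ℂ)` (`2e + 2(m + n) = 2e' + 2(m' + n)`) on `c ∈ Hᵃ(X(ℂ); ℂ)` is
`k_*(pr_{W'*}(pr_X^* c ∪ γ))`: `pr_{W*}(pr_X^* c ∪ (k ▷ X)_* γ) = pr_{W*}(k ▷ X)_*((k ▷ X)^* pr_X^* c ∪ γ)
= (pr_{W'} ≫ k)_*(pr_X^* c ∪ γ)` (projection formula, `(k ▷ X) ≫ pr_X = pr_X`,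
`(k ▷ X) ≫ pr_W = pr_{W'} ≫ k`, functoriality of Gysin morphisms).
[cite: VoisinHodgeII2003, proof of Thm. 10.17 (10.8)] [cite: FultonYoungTableaux1997, Appendix B §B.1 (5)–(6)] -/
theorem complexGysin_comp_corrAction_eq_corrAction_whiskerRight (μ : OrientationFamily)
    {m m' n : ℕ} {W W' X : SchemeOver ℂ} (hW : IsSmoothProjective m W)
    (hW' : IsSmoothProjective m' W') (hX : IsSmoothProjective n X) (k : W' ⟶ W)
    {e e' a b b' : ℕ} (hab : a + 2 * e = b + 2 * n) (hbb' : b + 2 * m = b' + 2 * m')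
    (hee' : 2 * e + 2 * (m + n) = 2 * e' + 2 * (m' + n)) (hab' : a + 2 * e' = b' + 2 * n)
    (γ : complexBetti (W' ⊗ X) (2 * e)) :
    corrAction μ hW hX hab'
        (complexGysin μ (IsSmoothProjective.tensor_holds hW' hX)
          (IsSmoothProjective.tensor_holds hW hX) (k ▷ X) hee' γ) =
      complexGysin μ hW' hW k hbb' ∘ₗ corrAction μ hW' hX hab γ := by
  have hμ := μ.hasPoincareDuality
  have hWX := IsSmoothProjective.tensor_holds hW hX
  have hW'X := IsSmoothProjective.tensor_holds hW' hX
  refine LinearMap.ext fun c ↦ ?_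
  rw [LinearMap.comp_apply, corrAction_apply, corrAction_apply,
    ← complexGysin_cup hμ hW'X hWX (k ▷ X) rfl
      (show a + 2 * e + 2 * (m + n) = a + 2 * e' + 2 * (m' + n) by omega) _ rfl,
    ← CategoryTheory.comp_apply, ← complexBetti.map_comp, whiskerRight_snd, ← LinearMap.comp_apply,
    ← complexGysin_comp hμ hW'X hWX hW (k ▷ X) (fst W X)]
  simp only [whiskerRight_fst]
  rw [complexGysin_comp hμ hW'X hW' hW (fst W' X) k (corrAction_degree m' hab) hbb',
    LinearMap.comp_apply]

/-- **Stub S2c of line `birth` (crux `ConiveauOneFailure`) — Gysin ∘ algebraic correspondence is an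
algebraic correspondence.** For `g : S → Y` (smooth projective surface to threefold), a smooth
projective curve `C` and an algebraic class `γ ∈ N¹H²((S ⊗ C)(ℂ); ℂ)`:
`g_* ∘ [γ]_* = [(g ▷ C)_* γ]_* : H¹(C(ℂ)) → H³(Y(ℂ))`
(`complexGysin_comp_corrAction_eq_corrAction_whiskerRight`) with
`(g ▷ C)_* γ ∈ N²H⁴((Y ⊗ C)(ℂ); ℂ)` algebraic (`complexGysin_mem_algebraicClasses`, support fact
`gysinMap_restrictCompl_eq_zero_of_field ℂ`), hence induced by an algebraic correspondence
(`isAlgebraicCorrespondence_corrAction`, `OrientationFamily.hasPoincareDuality`).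
[cite: Fulton1998, §16.1 Prop. 16.1.1] [cite: FultonYoungTableaux1997, Appendix B §B.1 (5)–(6)] -/
theorem stub_isAlgebraicCorrespondence_gysin_comp_corrAction :
    ∀ (μ : OrientationFamily) ⦃Y S C : SchemeOver ℂ⦄ (hY : IsSmoothProjective 3 Y)
      (hS : IsSmoothProjective 2 S) (hC : IsSmoothProjective 1 C) (g : S ⟶ Y)
      (γ : complexBetti (S ⊗ C) (2 * 1)), γ ∈ algebraicClasses (S ⊗ C) 1 →
        IsAlgebraicCorrespondence 3 1 Y C
          (complexGysin μ hS hY g (show 1 + 2 * 3 = 3 + 2 * 2 by norm_num) ∘ₗ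
            corrAction μ hS hC (show 1 + 2 * 1 = 1 + 2 * 1 from rfl) γ) := by
  intro μ Y S C hY hS hC g γ hγ
  rw [← complexGysin_comp_corrAction_eq_corrAction_whiskerRight μ hY hS hC g _ _
    (show 2 * 1 + 2 * (3 + 1) = 2 * 2 + 2 * (2 + 1) by norm_num)
    (show 1 + 2 * 2 = 3 + 2 * 1 by norm_num)]
  exact isAlgebraicCorrespondence_corrAction μ μ.hasPoincareDuality hY hC _
    (show 3 + 3 = 2 * 3 by norm_num)
    (complexGysin_mem_algebraicClasses (gysinMap_restrictCompl_eq_zero_of_field ℂ) μ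
      μ.hasPoincareDuality (IsSmoothProjective.tensor_holds hS hC)
      (IsSmoothProjective.tensor_holds hY hC) (g ▷ C) (show 1 + (3 + 1) = 2 + (2 + 1) by norm_num)
      _ hγ)

end Summit.HodgeConjecture.HodgeConjecture.Theorems

end
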